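import Literature.MathematicalPhysics.QuantumFieldTheory.Balaban1983to89.B8Real123FlatTranslateRec
import Literature.MathematicalPhysics.QuantumFieldTheory.Balaban1983to89.Node00.CarriersB8CubeDentedRecTranslate
import Literature.MathematicalPhysics.QuantumFieldTheory.Balaban1983to89.B8Prop6DentedCubeMemberScalarGammaHolds

/-!
# `Balaban1983to89.B8Real123CubeMemberRec` — [Balaban1985RegularSpaces] (1.91)–(1.92), (1.98), (1.101) (= [Balaban1985BackgroundPropagators] THEOREMS 3.1–3.2 AT `U = 1`)
# ON THE CUBE MEMBER `{□_j}` OF (1.131) AND ON THE DENTED CUBE TOWER `{Ω′_j}` OF [Balaban1985Variational] (148)–(150), FOR THE RECORD's CENTRED TOWER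
# ([Balaban1987RG1] (0.3)) — the record twins of dag-n05-c's `B8Thm32GBoundCubeMemberHolds.prop6_real123_printed` (pure member, every truncation) and of
# `B8Real123DentedCubeMember.Real123DentedCubeMemberPrinted` (dented member, top truncation), BOTH UNCONDITIONAL by translation (`B8Real123FlatTranslateRec`)

statement-level skeleton of published theorems with citation tags; proofs where landed; nothing here is a claim about the Yang–Mills mass gap

CITATION HEADER (lean-in-tree rule).  Cell `pub-ymgap` (HUMAN RULING D-0062), «N05-REC» road (director-ym №254∕№255; LEAD PEN dag-n05-e g38; desk `R6-PLAN.md` §2 row (e)′-3: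
the engine crown `B8Prop6DentedCubeMemberScalarGammaOfNamedFacts` feeds the γ-crown's REAL hypothesis from `prop6_real123_printed` below the top truncation and from
`Real123DentedCubeMemberPrinted` at the top; its record twin consumes THIS file's `prop6_real123_printedZ` and `Real123DentedCubeMemberPrintedZ`).  [6] =
[Balaban1985RegularSpaces] (1.91)–(1.92) p. 91, (1.98) p. 92, (1.101) p. 93, (1.131) p. 99, p. 98, (1.4) p. 77; [4] = [Balaban1985BackgroundPropagators] Thm 3.1 (3.47) p. 398,
Thm 3.2 (3.48) p. 398; [15] = [Balaban1985Variational] p. 300, (148)–(151) p. 301; [B6] = [Balaban1984PropagatorsII] Prop. 2.3 (2.87) p. 238; [I] = [Balaban1987RG1] (0.3)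
p. 252.  `--kind definition --supports stmt-QuantumFields-20541` (K0⁷; count-neutral).
REUSED BY NAME: the engine theorems `B8Thm32GBoundCubeMemberHolds.prop6_real123_printed` (dag-n05-c; pure member, PROVED),
`B8Prop6DentedCubeMemberScalarGammaOfGBound.real123Dented_of_real1_gbound` with `B8Eq1101DentedCubeMemberRealPrinted.{real1DentedCubeMemberPrinted_of_one_le,
real1M4DentedCubeMemberPrinted_of_one_le}` and `B8Thm32GBoundDentedCubeMemberHolds.gBoundDentedCubeMemberPrinted_of_one_le` (this lineage g31∕g32; dented member,
PROVED); the transfer `B8Real123FlatTranslateRec.real123Block_translate`; the dictionaries `B8Ineq159FlatCubeMemberPrintedRec.{image_add_ctrShift_cubeFamZ,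
image_add_ctrShift_cubeLamSZ}` (pure) and `Node00.CubeB8DZ.{translate, image_add_ctrShift_sq, image_add_ctrShift_lamS, anchored_translate}`
(`Node00/CarriersB8CubeDentedRecTranslate`, dented); print's weights `B8Eq1101CubeMemberWeights.wPrinted` (dag-n05-c).
WHAT IS PROVED (sorry-free).  §1 ★★ `prop6_real123_printedZ (d ℓ) (1 ≤ ℓ) (Odd (ℓ+1))` — the statement of `prop6_real123_printed d ℓ` with `cubeFam false ↦ cubeFamZ false`,
`cubeLamS ↦ cubeLamSZ`, `blockMap ((ℓ+1)ʲ) ↦ flmZ (ℓ+1) j`, the REAL block packaged as `Real123Block` — UNCONDITIONAL (same constants and thresholds).  §2 def ★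
`Real123DentedCubeMemberPrintedZ d ℓ` (the record twin of `Real123DentedCubeMemberPrinted d ℓ`: `CubeB8D ↦ CubeB8DZ`, labels `flmZ`, the dent premise on the grid of side
`M_hL^{k+1}` anchored at the RECORD's fine lower corner `Lᵏ(c.a − c.ρ) − c_k·𝟙`), ★★ `real123DentedCubeMemberPrintedZ_of_printed (Odd (ℓ+1))` (engine ⟹ record), ★★★
`real123DentedCubeMemberPrintedZ_holds (d ℓ) (1 ≤ ℓ) (Odd (ℓ+1))` — UNCONDITIONAL.
HONEST SCOPE.  Flat-background bookkeeping transfers of already-proved theorems; no new estimate; nothing of [4]∕[6]∕[15]∕[B6]∕[I] newly asserted; `HThm4Rec` UNDISCHARGED;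
N05 ∕ N07 NOT discharged; counts unmoved (typed 28∕28 · discharged 8∕28); one finite 𝕋⁴ programme at fixed ε — nothing continuum ∕ ℝ⁴ ∕ OS ∕ mass gap ∕ Clay.  No `instance`,
no `notation`, no `sorry`.
-/

set_option autoImplicit false
noncomputable section
open scoped BigOperators Matrix

namespace Literature.MathematicalPhysics.QuantumFieldTheory.Balaban1983to89.B8Real123CubeMemberRec

open BlockAveragingZd (ctrShift)
open Literature.MathematicalPhysics.QuantumLattice (blockMap)
open B8Eq119TwistedAxialRec (flmZ)
open B8Eq131CubesAdmissible (cubeFam)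
open B8Eq131CubesAdmissibleRec (cubeFamZ)
open B8CubeMemberZd (cubeLamS)
open B8CubeMemberZdRec (cubeLamSZ)
open B8Eq1101CubeMemberWeights (wPrinted)
open B8Real123FlatTranslateRec (Real123Block real123Block_translate)
open B8Ineq159FlatCubeMemberPrintedRec (image_add_ctrShift_cubeFamZ image_add_ctrShift_cubeLamSZ)
open B8Thm32GBoundCubeMemberHolds (prop6_real123_printed)
open B8Real123DentedCubeMember (Real123DentedCubeMemberPrinted)
open B8Prop6DentedCubeMemberScalarGammaOfGBound (real123Dented_of_real1_gbound)
open B8Eq1101DentedCubeMemberRealPrinted (real1DentedCubeMemberPrinted_of_one_le real1M4DentedCubeMemberPrinted_of_one_le)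
open B8Thm32GBoundDentedCubeMemberHolds (gBoundDentedCubeMemberPrinted_of_one_le)
open Node00 (CubeB8D CubeB8DZ)

/-! ## §1 The pure cube member, every truncation, centred tower -/

/-- ★★ (RECORD TWIN of `B8Thm32GBoundCubeMemberHolds.prop6_real123_printed`.) **[Balaban1985RegularSpaces] (1.91)–(1.92), (1.101), (1.98) AT `U = 1` ON THE CENTRED CUBE
MEMBER `{□_j}` OF (1.131), EVERY TRUNCATION `1 ≤ n ≤ k`, UNCONDITIONAL** (`L = ℓ + 1` odd, `ℓ ≥ 1`): the three REAL inequality families of the flat p6 consumer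
(`Real123Block`, centred labels `flmZ`) on the explicit matrices of the record tower `cubeFamZ false (ℓ+1) a M ρ k` with cells `cubeLamSZ (ℓ+1) a M ρ k n` at print's
weights `wPrinted`, for every cube datum on print's p. 98 big-block sub-lattice (`M_hL ∣ ρ`, `M_hL ∣ M`, `ρ ≥ R·M_hL`, `R ≥ 2L`, `N₀ + 1 ≤ R·L·M_h`, `ρ₀ ≤ ρ`), above
threshold.  Proof: the engine theorem on the translated datum (same `a, M, ρ, k`; `cubeFamZ + c_k = cubeFam`, `cubeLamSZ + c_{k−j} = cubeLamS`) and `real123Block_translate`.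
Same constants `B_G, B′₀ᴴ, B′₂, B_R, ρ₀, M₀, N₀` as the engine's.
[cite: Balaban1985RegularSpaces, (1.91)–(1.92) p.91, (1.98) p.92, (1.101) p.93, p.98; Balaban1985BackgroundPropagators, Theorem 3.1 (3.47) p.398, Theorem 3.2 (3.48) p.398; Balaban1984PropagatorsII, Prop. 2.3 (2.87) p.238; Balaban1987RG1, (0.3) p.252] -/
theorem prop6_real123_printedZ (d ℓ : ℕ) (hℓ : 1 ≤ ℓ) (hodd : Odd (ℓ + 1)) :
    ∃ BG B₀'H B₂' BR ρ₀ M₀ : ℝ, ∃ N₀ : ℕ, 0 < BG ∧ 0 < B₀'H ∧ 0 ≤ B₂' ∧ 0 ≤ BR ∧ 0 < M₀ ∧ 0 < N₀ ∧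
      ∀ (η : ℝ), 0 < η → ∀ (Mh : ℕ), 3 ≤ Mh → M₀ ≤ ((ℓ : ℝ) + 1) * Mh →
      ∀ (a : Fin (d + 1) → ℤ) (M ρ k n R : ℕ), 1 ≤ n → n ≤ k → Mh * (ℓ + 1) ∣ ρ → Mh * (ℓ + 1) ∣ M → 0 < ρ →
        R * (Mh * (ℓ + 1)) ≤ ρ → 2 * (ℓ + 1) ≤ R → N₀ + 1 ≤ R * ((ℓ + 1) * Mh) → ρ₀ ≤ (ρ : ℝ) →
      Real123Block (ℓ + 1) (flmZ (ℓ + 1)) η n (wPrinted d ℓ η) (cubeFamZ false (ℓ + 1) a M ρ k) (cubeLamSZ (ℓ + 1) a M ρ k n) BG B₀'H B₂' BR := by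
  obtain ⟨BG, B₀'H, B₂', BR, ρ₀, M₀, N₀, hBG, hB₀'H, hB₂', hBR, hM₀, hN₀, H⟩ := prop6_real123_printed d ℓ hℓ
  refine ⟨BG, B₀'H, B₂', BR, ρ₀, M₀, N₀, hBG, hB₀'H, hB₂', hBR, hM₀, hN₀, ?_⟩
  intro η hη Mh hMh hM0 a M ρ k n R hn1 hnk hρdiv hMdiv hρpos hRρ h2R hN01 hρ0
  have hE : Real123Block (ℓ + 1) (fun j => blockMap ((ℓ + 1) ^ j)) η n (wPrinted d ℓ η) (cubeFam false (ℓ + 1) a M ρ k)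
      (cubeLamS (ℓ + 1) a M ρ k n) BG B₀'H B₂' BR :=
    H η hη Mh hMh hM0 a M ρ k n R hn1 hnk hρdiv hMdiv hρpos hRρ h2R hN01 hρ0
  have hfam : cubeFam false (ℓ + 1) a M ρ k = fun j => (fun x : Fin (d + 1) → ℤ => x + fun _ => (ctrShift (ℓ + 1) k : ℤ)) '' cubeFamZ false (ℓ + 1) a M ρ k j :=
    funext fun j => (image_add_ctrShift_cubeFamZ hodd false a M ρ k j).symm
  have hlam : cubeLamS (ℓ + 1) a M ρ k n = fun j => (fun z : Fin (d + 1) → ℤ => z + fun _ => (ctrShift (ℓ + 1) (k - j) : ℤ)) '' cubeLamSZ (ℓ + 1) a M ρ k n j :=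
    funext fun j => (image_add_ctrShift_cubeLamSZ (ℓ + 1) a M ρ k n j).symm
  rw [hfam, hlam] at hE
  exact real123Block_translate hodd hnk hE

/-! ## §2 The dented cube member, top truncation, centred tower -/

/-- (RECORD TWIN of `B8Real123DentedCubeMember.Real123DentedCubeMemberPrinted`.) **[Balaban1985RegularSpaces] (1.91)–(1.92), (1.101), (1.98) AT `U = 1` ON THE DENTED
RECORD CUBE TOWER `{Ω′_j}` OF [Balaban1985Variational] (148)–(150), TOP TRUNCATION** ([4] Theorems 3.1–3.2 for the operators «defined … for the sequence {Ω′_j} instead of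
{Ω_j}», [15] p. 301): constants `B_G > 0`, `B′₀ᴴ > 0`, `B′₂, B_R ≥ 0` and thresholds `ρ₀, M₀, N₀` such that for every `η > 0`, `M_h ≥ 3` with `M₀ ≤ L·M_h`, every
dented RECORD cube datum `c : CubeB8DZ (d+1) (ℓ+1) K Ω` on print's big-block sub-lattice (`M_hL ∣ c.ρ`, `M_hL ∣ c.M`, `R·M_hL ≤ c.ρ`, `2L ≤ R`, `N₀ + 1 ≤ R·L·M_h`,
`ρ₀ ≤ c.ρ`) whose ambient top member `Ω_k` is a union of cubes of side `M_hL^{k+1}` of the grid anchored at `□_k`'s fine lower corner `Lᵏ(c.a − c.ρ) − c_k·𝟙` (centred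
blow-up; (1.4)₂), the three REAL families (`Real123Block`, centred labels `flmZ`, print's weights `wPrinted`) hold on the dented record tower `c.sq` with cells `c.lamS`.
The matrix of the engine's `Real123DentedCubeMemberPrinted d ℓ` under `CubeB8D ↦ CubeB8DZ`, `blockMap ((ℓ+1)ʲ) ↦ flmZ (ℓ+1) j`, record anchor.  Named here; PROVED
below (`real123DentedCubeMemberPrintedZ_holds`).
[cite: Balaban1985RegularSpaces, (1.91)–(1.92) p.91, (1.98) p.92, (1.101) p.93, p.98, (1.4) p.77; Balaban1985BackgroundPropagators, Theorem 3.1 (3.47) p.398, Theorem 3.2 (3.48) p.398; Balaban1985Variational, (148)–(151) p.301, p.300; Balaban1984PropagatorsII, Prop. 2.3 (2.87) p.238; Balaban1987RG1, (0.3) p.252] -/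
def Real123DentedCubeMemberPrintedZ (d ℓ : ℕ) : Prop :=
  ∃ BG B₀'H B₂' BR ρ₀ M₀ : ℝ, ∃ N₀ : ℕ, 0 < BG ∧ 0 < B₀'H ∧ 0 ≤ B₂' ∧ 0 ≤ BR ∧
    ∀ (η : ℝ), 0 < η → ∀ (Mh : ℕ), 3 ≤ Mh → M₀ ≤ ((ℓ : ℝ) + 1) * Mh →
    ∀ (K' : ℕ) (Ω : ℕ → Set (Fin (d + 1) → ℤ)) (c : CubeB8DZ (d + 1) (ℓ + 1) K' Ω) (R : ℕ),
      Mh * (ℓ + 1) ∣ c.ρ → Mh * (ℓ + 1) ∣ c.M → R * (Mh * (ℓ + 1)) ≤ c.ρ → 2 * (ℓ + 1) ≤ R → N₀ + 1 ≤ R * ((ℓ + 1) * Mh) → ρ₀ ≤ (c.ρ : ℝ) →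
      (∀ x y : Fin (d + 1) → ℤ,
          blockMap (Mh * (ℓ + 1) ^ (c.k + 1)) (x - fun i => (((ℓ + 1 : ℕ) : ℤ)) ^ c.k * (c.a i - c.ρ) - (ctrShift (ℓ + 1) c.k : ℤ)) =
            blockMap (Mh * (ℓ + 1) ^ (c.k + 1)) (y - fun i => (((ℓ + 1 : ℕ) : ℤ)) ^ c.k * (c.a i - c.ρ) - (ctrShift (ℓ + 1) c.k : ℤ)) →
          x ∈ Ω c.k → y ∈ Ω c.k) →
      Real123Block (ℓ + 1) (flmZ (ℓ + 1)) η c.k (wPrinted d ℓ η) c.sq c.lamS BG B₀'H B₂' BR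

/-- ★★ **THE RECORD FACT FROM THE ENGINE FACT, BY TRANSLATION** (odd `L = ℓ + 1`): the engine fact at the translated datum `c.translate` (whose dented tower and cells are
the record's translated, `image_add_ctrShift_sq ∕ _lamS`; dent premise by `anchored_translate`) is the ENGINE-labelled block on the translated tower, and
`real123Block_translate` returns the record block.  Same constants. [cite: Balaban1985RegularSpaces, (1.91)–(1.92) p.91, (1.98) p.92, (1.101) p.93; Balaban1985Variational, (148)–(151) p.301; Balaban1987RG1, (0.3) p.252] -/
theorem real123DentedCubeMemberPrintedZ_of_printed (d ℓ : ℕ) (hodd : Odd (ℓ + 1)) (h : Real123DentedCubeMemberPrinted d ℓ) :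
    Real123DentedCubeMemberPrintedZ d ℓ := by
  obtain ⟨BG, B₀'H, B₂', BR, ρ₀, M₀, N₀, hBG, hB₀'H, hB₂', hBR, H⟩ := h
  refine ⟨BG, B₀'H, B₂', BR, ρ₀, M₀, N₀, hBG, hB₀'H, hB₂', hBR, ?_⟩
  intro η hη Mh hMh hM0 K' Ω c R hρdiv hMdiv hRρ h2R hN01 hρ0 hΩ
  have hE : Real123Block (ℓ + 1) (fun j => blockMap ((ℓ + 1) ^ j)) η (c.translate hodd).k (wPrinted d ℓ η) (c.translate hodd).sq (c.translate hodd).lamS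
      BG B₀'H B₂' BR :=
    H η hη Mh hMh hM0 K' _ (c.translate hodd) R hρdiv hMdiv hRρ h2R hN01 hρ0 (c.anchored_translate hΩ)
  have hsq : (c.translate hodd).sq = fun j => (fun x : Fin (d + 1) → ℤ => x + fun _ => (ctrShift (ℓ + 1) c.k : ℤ)) '' c.sq j :=
    funext fun j => (c.image_add_ctrShift_sq hodd j).symm
  have hlam : (c.translate hodd).lamS = fun j => (fun z : Fin (d + 1) → ℤ => z + fun _ => (ctrShift (ℓ + 1) (c.k - j) : ℤ)) '' c.lamS j :=
    funext fun j => (c.image_add_ctrShift_lamS hodd j).symm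
  rw [hsq, hlam] at hE
  exact real123Block_translate hodd le_rfl hE

/-- ★★★ **(1.91)–(1.92), (1.101), (1.98) AT `U = 1` ON THE DENTED RECORD CUBE TOWER, TOP TRUNCATION — UNCONDITIONAL** (`L = ℓ + 1` odd, `ℓ ≥ 1`): the engine's dented fact,
assembled from the PROVED dented REAL-1 ∕ REAL-1′ ∕ 𝒢-bound facts (`real123Dented_of_real1_gbound`, `real1DentedCubeMemberPrinted_of_one_le`,
`real1M4DentedCubeMemberPrinted_of_one_le`, `gBoundDentedCubeMemberPrinted_of_one_le`), moved to the record tower by `real123DentedCubeMemberPrintedZ_of_printed`.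
[cite: Balaban1985RegularSpaces, (1.91)–(1.92) p.91, (1.98) p.92, (1.101) p.93; Balaban1985BackgroundPropagators, Theorem 3.1 (3.47) p.398, Theorem 3.2 (3.48) p.398; Balaban1985Variational, (148)–(151) p.301; Balaban1984PropagatorsII, Prop. 2.3 (2.87) p.238; Balaban1987RG1, (0.3) p.252] -/
theorem real123DentedCubeMemberPrintedZ_holds (d ℓ : ℕ) (hℓ : 1 ≤ ℓ) (hodd : Odd (ℓ + 1)) : Real123DentedCubeMemberPrintedZ d ℓ :=
  real123DentedCubeMemberPrintedZ_of_printed d ℓ hodd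
    (real123Dented_of_real1_gbound d ℓ hℓ (real1DentedCubeMemberPrinted_of_one_le d ℓ hℓ) (real1M4DentedCubeMemberPrinted_of_one_le d ℓ hℓ)
      (gBoundDentedCubeMemberPrinted_of_one_le d ℓ hℓ))

end Literature.MathematicalPhysics.QuantumFieldTheory.Balaban1983to89.B8Real123CubeMemberRec

end

/-! ## Axiom audit (gate whitelist: `propext`, `Classical.choice`, `Quot.sound`) -/
#print axioms Literature.MathematicalPhysics.QuantumFieldTheory.Balaban1983to89.B8Real123CubeMemberRec.prop6_real123_printedZ
#print axioms Literature.MathematicalPhysics.QuantumFieldTheory.Balaban1983to89.B8Real123CubeMemberRec.real123DentedCubeMemberPrintedZ_holds
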